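import Summits.QuantumFields.YangMills.Theorems.UnitScaleTiltProp7SectET3NormH1
import Summits.QuantumFields.YangMills.Theorems.UnitScaleTiltProp7SectET3N06LeavesRecordH
import HarnessLib

/-!
# Route `UnitScaleTilt`, crux «MinimiserStabilityRegPr» (stmt-QuantumFields-19200, v10 stub EX, route (α), node N06(d = 3)) — **THE `norm_H₁` ROW OF C-min FROM THE TEXT OF RECORD**:
# Track A's leaf of record `B9Thm312WholeLeafCompletePairMBZ.thm312Printed_completePairMBZ` (Theorem 3.12 as the whole printed leaf `B9.Thm312Printed` — the `norm_H₁` SIDE —, residual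
# ABSORBED, Z-classed H-letters, carrier-relative co-readings) READ AT `KIdx 2 ℓ hd3 hL 1 1 ∕ geo9K ∕ bgT3` (✓ `t312_of_pins_T3_completePairMBZ`), COMPOSED WITH THE UNITS ∕ SUMMATION
# READING OF (3.133) (✓ `Prop7SectET3NormH1.normH₁_row_of_t312_classTransfer`) — OWNER ym3-torus-plan g26 ASSIGNMENTS 10 (a): «the `norm_H₁` ROW of `Cmin_of_P6T3_chart_growth_pd` from
# `t312_of_pins_T3_completePairMBZ` + (U) + (Σ) as ONE kernel statement, species RECORD, mirror of ✓ p605632»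

Cell `ym3-torus` (HUMAN RULING D-0037, YM ladder rung R3 — NOT the Clay problem), width seat ym-ust-20520-w1 g4.  Count-neutral helper (`--supports stmt-QuantumFields-19200 --as
helper`); registry untouched; THEOREMS ONLY (0 `def`, 0 `sorry`); NOTHING of [Balaban1985BackgroundPropagators] is asserted.

WHAT.  ★★★ `normH₁_row_of_recordObligations` = `Prop7SectET3NormH1.normH₁_row_of_t312_classTransfer` ∘ `Prop7SectET3N06LeavesRecordH.t312_of_pins_T3_completePairMBZ` (✓ p604967) at the
band `b₀ = b₁ = 1` of `memberIdx`, pins `HasRWExpOfOps`∕`HasRWExpHOfOps`∕`PosDefKOfOps`: the displayed `norm_H₁` row of `Cmin_of_P6T3_chart_growth_pd` (shape `RegPr … e U₀ → e ≤ a₀∕(L·L^{a'}) →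
‖Hop (memberIdx …) (cfgV1OfT3 U₀) b‖ ≤ B₀′‖b‖`, above the M-threshold) FROM the record-species obligations of the Theorem 3.12 leaf (letter records `𝔬`, probes `𝔭`, input norms `bHX`,
direction letters `Dd ∕ Dds`, the kernel families `GD`, `G₁` and the H-kernels `Hk`, `H₁k` with their carrier-relative co-readings, symmetry, `hmodel` (Thm 3.3 for `G₀` = XL), `hleft`,
Z-classed H-letters `hlettersH`∕`hLHH`, `hG0C`, steps, numerics) + ★w1 g2's `ClassTransferT3` (BG-336) + the (U)∕(Σ) pin of a selected H-kernel `Hsel i ∈ {Hk i, H₁k i}` for an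
OPAQUE operator family `Hop` — the DEPMAP edge «N06(d = 3) [text of record] → norm_H₁» as ONE kernel statement, residual-free; (Σ) = [4] (2.61) and `0 < L^{j}η` are DISCHARGED
inside (`rowSum261_geo9K`, `geoOK_geo9K`).  The twin of ✓ `Prop7SectET3N06LeavesRecordNormG.normG_row_of_recordObligations` (p605632).
HONEST SCOPE: a by-name port at d := 2 over the floor subtype (inside p604967); every analytic row stays a displayed hypothesis (incl. the XL item `Thm33G0`); the route's curved
letter `H₁f` stays OPAQUE until a supplier DEFINES it and proves the pin; N06(d = 3) NOT discharged; nothing here claims EX, the crux, V3∕R3, d = 4 or the mass gap; YM₃ on T³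
is ladder rung R3, not the Clay problem.

References: T. Bałaban, CMP **99** (1985) 389–434 [Balaban1985BackgroundPropagators]; CMP **102** (1985) 277–309 [Balaban1985Variational]; CMP **96** (1984) 223–250
[Balaban1984PropagatorsII]; CMP **99** (1985) 75–102 [Balaban1985RegularSpaces].
-/

set_option autoImplicit false

noncomputable section

open scoped Matrix.Norms.L2Operator

namespace Summit.QuantumFields.YangMills.Theorems.Prop7SectET3N06LeavesRecordNormH1

open Literature.MathematicalPhysics.QuantumFieldTheory.Balaban1983to89
open Finset B6RandomWalk B6RandomWalkHom B9Thm34Ext B9Thm37Glue B9Thm37GlueCor36 B11SectG B9SectDSup B9SectDL2Decay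
open B9Thm37AllNorms B9Thm37AllNormsInstances B9FromB6 B9FromB6ModelSignsOn B9SectBStepWhole B9Thm312Whole B9Thm312WholeLeaf
open B9Thm312WholeLeft B9Thm312WholeH B9Thm312WholeLeafLeftGlob B9Ineq347CoReading B9SectCDiffDict B9CoRealizesRel B9CoRealizesHRel
open B9RWSums343Holder B9RWSumsReadsRel B9RWSumsReadsNbr B9Ineq347 B9Thm312WholeClasses B9Thm312WholeHolder B9Thm312WholeL2
open B9Thm312WholeBlocksRel B9Thm312WholeBlocksNbr B9Thm312WholeLeafAll B9Thm312WholeHHolder B9Thm312WholeHHolderNbr B9Thm312WholeLeafRelH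
open B9RWSums346SecondDiff B9Thm312WholeLeafCompleteNbr B9Thm312WholeBlocksNbrRec B9RWSums344InputFam B9Thm312WholeDir
open B9Thm312WholeBlocksPairM B9Thm312WholeLeafCompletePairM B9Thm312WholeDirB B9Thm312WholeBlocksPairMB B9Thm312WholeHZ B9Thm312WholeLeafRelHZ
open B6KLevelCensusIndexV1 (KIdx)
open B9GeoNormsKLevelV1 (geo9K)
open B9CoRealizesRelAtLetters (RelB)
open Summit.QuantumFields.YangMills.Theorems.Prop7SectET3Members (hd3 memberIdx)
open Summit.QuantumFields.YangMills.Theorems.Prop7SectET3Geometry (geoOK_geo9K)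
open Summit.QuantumFields.YangMills.Theorems.Prop7SectET3BgClass (bgT3 cfgV1OfT3 ClassTransferT3)
open Summit.QuantumFields.YangMills.Theorems.Prop7SectET3NormH1 (normH₁_row_of_t312_classTransfer)
open Summit.QuantumFields.YangMills.Theorems.Prop7SectET3N06LeavesRecordH (t312_of_pins_T3_completePairMBZ)
open T3ContinuumYM3Torus T3PrintedRegularMinimiser B6GlobalChartV1

variable {ℓ : ℕ} {hL : Odd (ℓ + 1) ∧ 1 < ℓ + 1} {c35 : ℝ}

/-- ★★★ **THE `norm_H₁` ROW OF C-min FROM THE RECORD-SPECIES N06(d = 3) OBLIGATIONS (THEOREM 3.12 SIDE) — ONE KERNEL STATEMENT, RESIDUAL-FREE** (`normH₁_row_of_t312_classTransfer` ∘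
`t312_of_pins_T3_completePairMBZ`, band `b₀ = b₁ = 1`): the displayed inputs of the Theorem 3.12 leaf of record at the T³ index (letter records, probes, input block norms, direction letters,
the kernel families `GD`, `G₁`, the H-kernels `Hk`, `H₁k` with their carrier-relative co-readings (`hcoR hco1R hcoHR hcoG hl2N hH1N hIF hHCN`), symmetry, `hmodel` (Thm 3.3 for `G₀` = XL),
`hleft`, the coarse block norm `bZ` (`κ = 1`) with the Z-classed H-letters `hlettersH`∕`hLHH`, `hG0C`, steps `hstepC`, numerics) + `ClassTransferT3 ℓ hL c35` + a selected H-kernel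
`Hsel i ∈ {Hk i, H₁k i}` + an operator family `Hop i U : Xo i U → Yo i U` read by `Hsel i`'s (3.133) entries through the (U)∕(Σ) pin (spare weight exponent `s`, `len^s ≤ 1`; the row
sum (2.61) and `0 < L^{j}η` discharged inside) give `M₄, a₀, B₀′ > 0` with, for every member `memberIdx ℓ hL hℓ m hm n K a' R …` whose `M = L·L^{a'}` clears `M₄`, every
`e ≤ a₀∕(L·L^{a'})`, every SU(2) field `U₀ ∈ RegPr ⟨ℓ+1, hL, m, hm⟩ n K e` and every `b`: `‖Hop (memberIdx …) (cfgV1OfT3 U₀) b‖ ≤ B₀′‖b‖` — the text of `SectEDatum.norm_H₁` ∕ (103).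
Nothing of print asserted; NOT a discharge of N06(d = 3).
[cite: Balaban1985Variational, (103) p.293, (115) p.294; Balaban1985BackgroundPropagators, Thm 3.12 pp.421-423, (3.133) p.422; Balaban1984PropagatorsII, (2.61) p.234; Balaban1985RegularSpaces, (1.33) p.82] -/
theorem normH₁_row_of_recordObligations [∀ i : KIdx 2 ℓ hd3 hL 1 1, Fintype (geo9K i).Site] [∀ i : KIdx 2 ℓ hd3 hL 1 1, DecidableEq (geo9K i).Site]
    {X Y Z W PX PY : KIdx 2 ℓ hd3 hL 1 1 → Type} {P : Type} [∀ i, Fintype (X i)] [∀ i, DecidableEq (X i)] [∀ i, Fintype (Y i)]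
    [∀ i, Fintype (Z i)] [∀ i, Fintype (W i)] [∀ i, Fintype (PX i)] [∀ i, Fintype (PY i)] [Fintype P]
    (𝔬 : ∀ i : KIdx 2 ℓ hd3 hL 1 1, Ops (geo9K i) (bgT3 i) (X i) (Y i) (Z i) (W i)) (H₀ : KIdx 2 ℓ hd3 hL 1 1 → Prop)
    (𝔭 : ∀ i : KIdx 2 ℓ hd3 hL 1 1, HolderProbes (geo9K i) (bgT3 i) (X i) (Y i) (PX i) (PY i))
    (bHX : ∀ i : KIdx 2 ℓ hd3 hL 1 1, ℝ → BlockNorm (toB6 (geo9K i) 1 (H₀ i)) (X i → ℝ))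
    (Dd Dds : ∀ i : KIdx 2 ℓ hd3 hL 1 1, (bgT3 i).Cfg → P → Module.End ℝ (X i → ℝ))
    (GD G₁ : ∀ i : KIdx 2 ℓ hd3 hL 1 1, B9.KernelFamily (geo9K i) (bgT3 i)) (Hk H₁k : ∀ i : KIdx 2 ℓ hd3 hL 1 1, B9.HKernel (geo9K i) (bgT3 i))
    (ev : ∀ i : KIdx 2 ℓ hd3 hL 1 1, (geo9K i).Loc → X i → ℝ) (evY : ∀ i : KIdx 2 ℓ hd3 hL 1 1, (geo9K i).Loc → Y i → ℝ)
    (r Cev θ₁ θD θ₂ r₁ B₀ B₂ δ₀ δK σ ρ ρf a₁ M₁ B₃ δ₃ α : ℝ) (Bh Bi Bq θH θI : ℝ → ℝ) (Bi2 : ℝ → ℝ → ℝ)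
    (hθ₁ : 0 ≤ θ₁) (hθD : 0 ≤ θD) (hθH : ∀ β, 0 ≤ β → β < 1 → 0 ≤ θH β) (hθI : ∀ ε, 0 < ε → 0 ≤ θI ε) (hθ₂ : 0 ≤ θ₂) (hr₁ : 0 ≤ r₁) (hB₀ : 0 ≤ B₀) (hB₂ : 0 ≤ B₂) (hB₃ : 0 ≤ B₃)
    (hσ : 0 < σ) (hρ : 0 < ρ) (hρS : ρ ≤ δ₀) (hρδ : ρ + σ ≤ δK) (hρ₃ : ρ + σ ≤ δ₃) (ha₁ : 0 < a₁) (hM₁ : 0 < M₁)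
    (hα : α ≤ 1 / 2) (hα0 : 0 < α) (hρf : 0 < ρf) (hρf1 : ρf + σ ≤ (1 - α) * ρ) (hρf2 : ρf + 2 * σ + α * ρ ≤ ρ)
    (hBh : ∀ β, 0 ≤ β → β < 1 → 0 ≤ Bh β) (hBi : ∀ ε, 0 < ε → ε ≤ 1 → 0 ≤ Bi ε)
    (hBi2 : ∀ ε β, 0 < ε → ε ≤ 1 → 0 ≤ β → β < 1 → 0 ≤ Bi2 ε β) (hBq : ∀ β, 0 ≤ Bq β)
    (hCev : 0 ≤ Cev)
    (hcoR : ∀ (i : KIdx 2 ℓ hd3 hL 1 1) (U : (bgT3 i).Cfg),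
      CoRealizesRel (GD i) 0 U (RelB i) (𝔬 i).blk (𝔬 i).blk (ev i) ((𝔬 i).G U) ∧
      CoRealizesRel (GD i) 2 U (RelB i) (𝔬 i).blk (𝔬 i).blkY (evY i) ((𝔬 i).G U ∘ₗ (𝔬 i).Dstar U) ∧
      CoRealizesRel (G₁ i) 0 U (RelB i) (𝔬 i).blk (𝔬 i).blk (ev i) ((𝔬 i).G1 U) ∧
      CoRealizesRel (G₁ i) 2 U (RelB i) (𝔬 i).blk (𝔬 i).blkY (evY i) ((𝔬 i).G1 U ∘ₗ (𝔬 i).Dstar U))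
    (hco1R : ∀ (i : KIdx 2 ℓ hd3 hL 1 1) (U : (bgT3 i).Cfg),
      CoRealizesRel (GD i) 1 U (RelB i) (𝔬 i).blkY (𝔬 i).blk (ev i) ((𝔬 i).D U ∘ₗ (𝔬 i).G U) ∧
      CoRealizesRel (G₁ i) 1 U (RelB i) (𝔬 i).blkY (𝔬 i).blk (ev i) ((𝔬 i).D U ∘ₗ (𝔬 i).G1 U))
    (hcoHR : ∀ (i : KIdx 2 ℓ hd3 hL 1 1) (U : (bgT3 i).Cfg),
      CoRealizesHRel (Hk i) 0 U (2 + 1) (RelB i) (𝔬 i).blk (𝔬 i).blkZ ((𝔬 i).Hm U) ∧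
      CoRealizesHRel (Hk i) 1 U (2 + 1) (RelB i) (𝔬 i).blkY (𝔬 i).blkZ ((𝔬 i).D U ∘ₗ (𝔬 i).Hm U) ∧
      CoRealizesHRel (H₁k i) 0 U (2 + 1) (RelB i) (𝔬 i).blk (𝔬 i).blkZ ((𝔬 i).H1m U) ∧
      CoRealizesHRel (H₁k i) 1 U (2 + 1) (RelB i) (𝔬 i).blkY (𝔬 i).blkZ ((𝔬 i).D U ∘ₗ (𝔬 i).H1m U))
    (hcoG : ∀ (i : KIdx 2 ℓ hd3 hL 1 1) (U : (bgT3 i).Cfg),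
      CoReadsGlob (GD i) 0 U (𝔬 i).blk (𝔬 i).blk (ev i) ((𝔬 i).G U) ∧
      CoReadsGlob (GD i) 1 U (𝔬 i).blkY (𝔬 i).blk (ev i) ((𝔬 i).D U ∘ₗ (𝔬 i).G U) ∧
      CoReadsGlob (GD i) 2 U (𝔬 i).blk (𝔬 i).blkY (evY i) ((𝔬 i).G U ∘ₗ (𝔬 i).Dstar U) ∧
      CoReadsGlob (G₁ i) 0 U (𝔬 i).blk (𝔬 i).blk (ev i) ((𝔬 i).G1 U) ∧
      CoReadsGlob (G₁ i) 1 U (𝔬 i).blkY (𝔬 i).blk (ev i) ((𝔬 i).D U ∘ₗ (𝔬 i).G1 U) ∧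
      CoReadsGlob (G₁ i) 2 U (𝔬 i).blk (𝔬 i).blkY (evY i) ((𝔬 i).G1 U ∘ₗ (𝔬 i).Dstar U))
    (hl2N : ∀ (i : KIdx 2 ℓ hd3 hL 1 1) (U : (bgT3 i).Cfg),
      (L2ReadsNbr (R := (1 : ℝ)) (H := H₀ i) (GD i) 0 U (RelB i) r Cev (𝔬 i).blk (𝔬 i).blk (ev i) ((𝔬 i).G U) ∧
        L2ReadsNbr (R := (1 : ℝ)) (H := H₀ i) (GD i) 1 U (RelB i) r Cev (𝔬 i).blkY (𝔬 i).blk (ev i) ((𝔬 i).D U ∘ₗ (𝔬 i).G U) ∧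
        L2ReadsNbr (R := (1 : ℝ)) (H := H₀ i) (GD i) 2 U (RelB i) r Cev (𝔬 i).blk (𝔬 i).blkY (evY i) ((𝔬 i).G U ∘ₗ (𝔬 i).Dstar U) ∧
        L2ReadsNbr (R := (1 : ℝ)) (H := H₀ i) (GD i) 3 U (RelB i) r Cev ((𝔬 i).blk ∘ Prod.fst) (𝔬 i).blk (ev i)
          (familyOp (fun q : P × P => Dd i U q.1 ∘ₗ ((𝔬 i).G U ∘ₗ Dds i U q.2))) ∧
        L2ReadsNbr (R := (1 : ℝ)) (H := H₀ i) (GD i) 4 U (RelB i) r Cev ((𝔬 i).blk ∘ Prod.fst) (𝔬 i).blk (ev i)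
          (familyOp (fun q : P × P => (Dd i U q.1 ∘ₗ Dd i U q.2) ∘ₗ (𝔬 i).G U)) ∧
        L2ReadsNbr (R := (1 : ℝ)) (H := H₀ i) (GD i) 5 U (RelB i) r Cev ((𝔬 i).blk ∘ Prod.fst) (𝔬 i).blk (ev i)
          (familyOp (fun q : P × P => (𝔬 i).G U ∘ₗ (Dds i U q.1 ∘ₗ Dds i U q.2)))) ∧
      (L2ReadsNbr (R := (1 : ℝ)) (H := H₀ i) (G₁ i) 0 U (RelB i) r Cev (𝔬 i).blk (𝔬 i).blk (ev i) ((𝔬 i).G1 U) ∧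
        L2ReadsNbr (R := (1 : ℝ)) (H := H₀ i) (G₁ i) 1 U (RelB i) r Cev (𝔬 i).blkY (𝔬 i).blk (ev i) ((𝔬 i).D U ∘ₗ (𝔬 i).G1 U) ∧
        L2ReadsNbr (R := (1 : ℝ)) (H := H₀ i) (G₁ i) 2 U (RelB i) r Cev (𝔬 i).blk (𝔬 i).blkY (evY i) ((𝔬 i).G1 U ∘ₗ (𝔬 i).Dstar U) ∧
        L2ReadsNbr (R := (1 : ℝ)) (H := H₀ i) (G₁ i) 3 U (RelB i) r Cev ((𝔬 i).blk ∘ Prod.fst) (𝔬 i).blk (ev i)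
          (familyOp (fun q : P × P => Dd i U q.1 ∘ₗ ((𝔬 i).G1 U ∘ₗ Dds i U q.2))) ∧
        L2ReadsNbr (R := (1 : ℝ)) (H := H₀ i) (G₁ i) 4 U (RelB i) r Cev ((𝔬 i).blk ∘ Prod.fst) (𝔬 i).blk (ev i)
          (familyOp (fun q : P × P => (Dd i U q.1 ∘ₗ Dd i U q.2) ∘ₗ (𝔬 i).G1 U)) ∧
        L2ReadsNbr (R := (1 : ℝ)) (H := H₀ i) (G₁ i) 5 U (RelB i) r Cev ((𝔬 i).blk ∘ Prod.fst) (𝔬 i).blk (ev i)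
          (familyOp (fun q : P × P => (𝔬 i).G1 U ∘ₗ (Dds i U q.1 ∘ₗ Dds i U q.2)))))
    (hH1N : ∀ (i : KIdx 2 ℓ hd3 hL 1 1) (U : (bgT3 i).Cfg),
      H1ReadsNbr (GD i) U (𝔭 i) (RelB i) r (𝔬 i).blk (𝔬 i).blkY (ev i) (evY i) ((𝔬 i).D U ∘ₗ (𝔬 i).G U)
        ((𝔬 i).G U ∘ₗ (𝔬 i).Dstar U) ∧
      H1ReadsNbr (G₁ i) U (𝔭 i) (RelB i) r (𝔬 i).blk (𝔬 i).blkY (ev i) (evY i) ((𝔬 i).D U ∘ₗ (𝔬 i).G1 U)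
        ((𝔬 i).G1 U ∘ₗ (𝔬 i).Dstar U))
    (hIF : ∀ (i : KIdx 2 ℓ hd3 hL 1 1) (U : (bgT3 i).Cfg),
      InputReadsFam (GD i) U (bHX i) r ((𝔬 i).blk ∘ Prod.fst) ((𝔭 i).blkPX ∘ Prod.fst) (fun β => sliceProbe ((𝔭 i).ΦX U β)) (ev i)
        (familyOp (fun q : P × P => Dd i U q.1 ∘ₗ ((𝔬 i).G U ∘ₗ Dds i U q.2))) ∧
      InputReadsFam (G₁ i) U (bHX i) r ((𝔬 i).blk ∘ Prod.fst) ((𝔭 i).blkPX ∘ Prod.fst) (fun β => sliceProbe ((𝔭 i).ΦX U β)) (ev i)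
        (familyOp (fun q : P × P => Dd i U q.1 ∘ₗ ((𝔬 i).G1 U ∘ₗ Dds i U q.2))))
    (hHCN : ∀ (i : KIdx 2 ℓ hd3 hL 1 1) (U : (bgT3 i).Cfg),
      CoReadsHHolderNbr (Hk i) U (2 + 1) (𝔭 i) r (𝔬 i).blkZ ((𝔬 i).D U ∘ₗ (𝔬 i).Hm U) ∧
      CoReadsHHolderNbr (H₁k i) U (2 + 1) (𝔭 i) r (𝔬 i).blkZ ((𝔬 i).D U ∘ₗ (𝔬 i).H1m U))
    (hsym : ∀ i : KIdx 2 ℓ hd3 hL 1 1, M₁ ≤ (geo9K i).M → ∀ α₀ : ℝ, 0 < α₀ → (geo9K i).M * α₀ ≤ a₁ →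
      ∀ U : (bgT3 i).Cfg, (bgT3 i).Reg335 c35 α₀ U → (bgT3 i).Reg336 c35 α₀ U →
        (IsTransposePair ((𝔬 i).G U) ((𝔬 i).G U) ∧ IsTransposePair ((𝔬 i).G1 U) ((𝔬 i).G1 U)) ∧
        (IsTransposePair ((𝔬 i).D U ∘ₗ (𝔬 i).G U) ((𝔬 i).G U ∘ₗ (𝔬 i).Dstar U) ∧
          IsTransposePair ((𝔬 i).D U ∘ₗ (𝔬 i).G1 U) ((𝔬 i).G1 U ∘ₗ (𝔬 i).Dstar U)))
    (hmodel : ∀ i : KIdx 2 ℓ hd3 hL 1 1, M₁ ≤ (geo9K i).M → ∀ α₀ : ℝ, 0 < α₀ → (geo9K i).M * α₀ ≤ a₁ →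
      ∀ U : (bgT3 i).Cfg, (bgT3 i).Reg335 c35 α₀ U → (bgT3 i).Reg336 c35 α₀ U →
        Thm33G0 (𝔬 i) 1 (H₀ i) B₀ δ₀ U ∧
        Step (𝔬 i) 1 (H₀ i) (geoOK_geo9K i).lenle 1 (θ₁ * ((geo9K i).M * α₀)) δK U ∧
        Step (𝔬 i) 1 (H₀ i) (geoOK_geo9K i).lenle 2 (θ₁ * ((geo9K i).M * α₀)) δK U ∧
        FormSmall (𝔬 i) (r₁ * ((geo9K i).M * α₀)) U ∧ Identities (𝔬 i) U)
    (hleft : ∀ i : KIdx 2 ℓ hd3 hL 1 1, M₁ ≤ (geo9K i).M → ∀ α₀ : ℝ, 0 < α₀ → (geo9K i).M * α₀ ≤ a₁ →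
      ∀ U : (bgT3 i).Cfg, (bgT3 i).Reg335 c35 α₀ U → (bgT3 i).Reg336 c35 α₀ U →
        LeftStep (𝔬 i) 1 (H₀ i) (geoOK_geo9K i).lenle B₀ δ₀ (θD * ((geo9K i).M * α₀)) δK U)
    (bZ : ∀ i : KIdx 2 ℓ hd3 hL 1 1, BlockNorm (toB6 (geo9K i) 1 (H₀ i)) (Z i → ℝ)) (hκZ : ∀ i : KIdx 2 ℓ hd3 hL 1 1, (bZ i).κ = 1)
    (hlettersH : ∀ i : KIdx 2 ℓ hd3 hL 1 1, M₁ ≤ (geo9K i).M → ∀ α₀ : ℝ, 0 < α₀ → (geo9K i).M * α₀ ≤ a₁ →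
      ∀ U : (bgT3 i).Cfg, (bgT3 i).Reg335 c35 α₀ U → (bgT3 i).Reg336 c35 α₀ U →
        LettersHZ (𝔬 i) 1 (H₀ i) (geoOK_geo9K i) (bZ i) B₃ δ₃ U)
    (hG0C : ∀ i : KIdx 2 ℓ hd3 hL 1 1, M₁ ≤ (geo9K i).M → ∀ α₀ : ℝ, 0 < α₀ → (geo9K i).M * α₀ ≤ a₁ →
      ∀ U : (bgT3 i).Cfg, (bgT3 i).Reg335 c35 α₀ U → (bgT3 i).Reg336 c35 α₀ U →
        Thm33G0Dir (𝔬 i) (𝔭 i) (Dd i) (Dds i) 1 (H₀ i) (bHX i) B₀ Bh Bi Bi2 δ₀ U ∧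
          Thm33G0L2M (𝔬 i) (Dd i) (Dds i) 1 (H₀ i) B₂ δ₀ U)
    (hstepC : ∀ i : KIdx 2 ℓ hd3 hL 1 1, M₁ ≤ (geo9K i).M → ∀ α₀ : ℝ, 0 < α₀ → (geo9K i).M * α₀ ≤ a₁ →
      ∀ U : (bgT3 i).Cfg, (bgT3 i).Reg335 c35 α₀ U → (bgT3 i).Reg336 c35 α₀ U →
        StepDirB (𝔬 i) (𝔭 i) (Dd i) (Dds i) 1 (H₀ i) (bHX i) (geoOK_geo9K i).lenle (θD * ((geo9K i).M * α₀))
          (fun β => θH β * ((geo9K i).M * α₀)) (fun ε => θI ε * ((geo9K i).M * α₀)) δK U ∧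
        StepL2 (𝔬 i) 1 (H₀ i) (θ₂ * ((geo9K i).M * α₀)) δK U)
    (hLHH : ∀ i : KIdx 2 ℓ hd3 hL 1 1, M₁ ≤ (geo9K i).M → ∀ α₀ : ℝ, 0 < α₀ → (geo9K i).M * α₀ ≤ a₁ →
      ∀ U : (bgT3 i).Cfg, (bgT3 i).Reg335 c35 α₀ U → (bgT3 i).Reg336 c35 α₀ U →
        LettersHHZ (𝔬 i) (𝔭 i) 1 (H₀ i) (geoOK_geo9K i).lenle (bZ i) Bq δ₃ U)
    -- ======== the class-transfer row (BG-336), the selected H-kernel and the operator family read by its (3.133) entries through the (U)∕(Σ) pin ========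
    (hCT : ClassTransferT3 ℓ hL c35)
    (Hsel : ∀ i : KIdx 2 ℓ hd3 hL 1 1, B9.HKernel (geo9K i) (bgT3 i)) (hmem : ∀ i, Hsel i = Hk i ∨ Hsel i = H₁k i)
    {Xo Yo : ∀ i : KIdx 2 ℓ hd3 hL 1 1, (bgT3 i).Cfg → Type} [∀ i U, SeminormedAddCommGroup (Xo i U)] [∀ i U, SeminormedAddCommGroup (Yo i U)]
    (Hop : ∀ (i : KIdx 2 ℓ hd3 hL 1 1) (U : (bgT3 i).Cfg), Xo i U → Yo i U) (s : ℝ)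
    (hls : ∀ (i : KIdx 2 ℓ hd3 hL 1 1) (y : (geo9K i).Site), (geo9K i).len y ^ s ≤ 1)
    (hpin : ∀ (i : KIdx 2 ℓ hd3 hL 1 1) (U : (bgT3 i).Cfg) (b : Xo i U) (c : ℝ), 0 ≤ c →
      (∀ (n : Fin 2) (y : (geo9K i).Site),
          (geo9K i).len y ^ ((n : ℝ) + s) * (∑ y' : (geo9K i).Site, (Hsel i).e n U y y' * (geo9K i).len y' ^ ((2 + 1 : ℕ) : ℝ)) * ‖b‖ ≤ c) →
        ‖Hop i U b‖ ≤ c) :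
    ∃ M₄ a₀ B₀' : ℝ, 0 < M₄ ∧ 0 < a₀ ∧ 0 < B₀' ∧
      ∀ (hℓ : 4 ≤ ℓ) (m : ℕ) (hm : 1 ≤ m) (n K a' R : ℕ) (hk1 : 1 ≤ K - n) (hsize : a' + 3 ≤ m + n) (hM8 : 8 ≤ (ℓ + 1) ^ a') (hR2 : 2 * (ℓ + 1) ^ 2 ≤ R),
        M₄ ≤ ((ℓ + 1 : ℕ) : ℝ) * (((ℓ + 1) ^ a' : ℕ) : ℝ) →
        ∀ (e : ℝ) (U₀ : GaugeField (PV 2 ℓ m K hd3 hL) 0 (Matrix.specialUnitaryGroup (Fin 2) ℂ)),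
          RegPr (⟨ℓ + 1, hL, m, hm⟩ : T3Family) n K e U₀ → e ≤ a₀ / (((ℓ + 1 : ℕ) : ℝ) * (((ℓ + 1) ^ a' : ℕ) : ℝ)) →
            ∀ b : Xo (memberIdx ℓ hL hℓ m hm n K a' R hk1 hsize hM8 hR2) (cfgV1OfT3 U₀),
              ‖Hop (memberIdx ℓ hL hℓ m hm n K a' R hk1 hsize hM8 hR2) (cfgV1OfT3 U₀) b‖ ≤ B₀' * ‖b‖ :=
  normH₁_row_of_t312_classTransfer
    (t312_of_pins_T3_completePairMBZ 𝔬 H₀ 𝔭 bHX Dd Dds GD G₁ Hk H₁k ev evY r Cev θ₁ θD θ₂ r₁ B₀ B₂ δ₀ δK σ ρ ρf a₁ M₁ B₃ δ₃ α Bh Bi Bq θH θI Bi2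
      hθ₁ hθD hθH hθI hθ₂ hr₁ hB₀ hB₂ hB₃ hσ hρ hρS hρδ hρ₃ ha₁ hM₁ hα hα0 hρf hρf1 hρf2 hBh hBi hBi2 hBq hCev hcoR hco1R hcoHR hcoG hl2N hH1N hIF hHCN hsym hmodel hleft
      bZ hκZ hlettersH hG0C hstepC hLHH
      (fun i => HasRWExpOfOps (𝔬 i)) (fun i => HasRWExpHOfOps (𝔬 i)) (fun i => PosDefKOfOps (𝔬 i)) (fun _ => rfl) (fun _ => rfl) (fun _ => rfl))
    hCT Hsel hmem Hop s hls hpin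

/-- ★★ **THE SAME ROW FOR PRINT'S FIRST H-KERNEL `H = GQ*(QGQ*)⁻¹` — [Balaban1985Variational] (45)–(46) AT THE T³ MEMBER OF RECORD** (OWNER RULING g26-№10 + ADDENDUM: the EX knit's
(46)-tw-H size row is N06-class and FOLDS into this lane; this corollary is `normH₁_row_of_recordObligations` at `Hsel := Hk`, `hmem := Or.inl rfl`, under a name that SAYS `H`).
PRINT: *«`L^jηQ_jHB = B` on Λ_j, `RD*HB = 0` (45) and the Theorem 3.12 from [5] implies `|HB| ≦ B₀(L^jη)^{−1}|B|`, `|∇HB| ≦ B₀(L^jη)^{−2}|B|` on Ω_j (46)»* (p. 285) — (46) is the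
(115)-currency bound `|HB|_{(−1)}, |∇_{U₀}HB|_{(−2)} ≤ B₀|B|`, i.e. (3.133)'s two sup members n = 0, 1 for [Balaban1985BackgroundPropagators] (3.126) `H` summed over y′ with (2.61) — the
(U)+(Σ) reading of ✓ `Prop7SectET3NormH1`; the leaf of record `t312_of_pins_T3_completePairMBZ` binds `Hk` (co-read against `(𝔬 i).Hm U`, `(𝔬 i).D U ∘ₗ (𝔬 i).Hm U` by `hcoHR`) exactly as it
binds `H₁k`.  Statement: the displayed record-species obligations + `ClassTransferT3 ℓ hL c35` + an operator family `Hop` read by `Hk i`'s (3.133) entries through the (U)∕(Σ) pin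
(spare exponent `s`; at the member `len ≡ 1`, ✓ `Prop7SectET3MemberLen`) ⟹ `M₄, a₀, B₀′ > 0` with `‖Hop (memberIdx …) (cfgV1OfT3 U₀) b‖ ≤ B₀′‖b‖` above the M-threshold for
`U₀ ∈ RegPr ⟨ℓ+1, hL, m, hm⟩ n K e`, `e ≤ a₀∕(L·L^{a'})`.  NOT PROVED HERE (proviso P1 of the ruling): the IDENTITY row (45) — it is `H`'s defining property ((3.126), (3.109)–(3.110)), the
algebraic row of the (L4) definition of the route's curved letter, not an N06 output; and (P2) the identification of print's linearised constraint `L^jηQ_j(U₀, ·)` with the EX chart's `QTw U₀`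
((S9)∕(L2)).  In the exponent scale of the route (`X = ηA`) the bound reads `‖H_route Y‖ ≤ B₀′·η·‖Y‖` by pure scaling at the one-level member.  Nothing of print asserted; NOT a
discharge of N06(d = 3).
[cite: Balaban1985Variational, (45)-(46) p.285, (115) p.294; Balaban1985BackgroundPropagators, (3.126) p.420, (3.133) p.422, Thm 3.12 pp.421-423; Balaban1984PropagatorsII, (2.61) p.234; Balaban1985RegularSpaces, (1.33) p.82] -/
theorem normH_row_of_recordObligations_H [∀ i : KIdx 2 ℓ hd3 hL 1 1, Fintype (geo9K i).Site] [∀ i : KIdx 2 ℓ hd3 hL 1 1, DecidableEq (geo9K i).Site]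
    {X Y Z W PX PY : KIdx 2 ℓ hd3 hL 1 1 → Type} {P : Type} [∀ i, Fintype (X i)] [∀ i, DecidableEq (X i)] [∀ i, Fintype (Y i)]
    [∀ i, Fintype (Z i)] [∀ i, Fintype (W i)] [∀ i, Fintype (PX i)] [∀ i, Fintype (PY i)] [Fintype P]
    (𝔬 : ∀ i : KIdx 2 ℓ hd3 hL 1 1, Ops (geo9K i) (bgT3 i) (X i) (Y i) (Z i) (W i)) (H₀ : KIdx 2 ℓ hd3 hL 1 1 → Prop)
    (𝔭 : ∀ i : KIdx 2 ℓ hd3 hL 1 1, HolderProbes (geo9K i) (bgT3 i) (X i) (Y i) (PX i) (PY i))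
    (bHX : ∀ i : KIdx 2 ℓ hd3 hL 1 1, ℝ → BlockNorm (toB6 (geo9K i) 1 (H₀ i)) (X i → ℝ))
    (Dd Dds : ∀ i : KIdx 2 ℓ hd3 hL 1 1, (bgT3 i).Cfg → P → Module.End ℝ (X i → ℝ))
    (GD G₁ : ∀ i : KIdx 2 ℓ hd3 hL 1 1, B9.KernelFamily (geo9K i) (bgT3 i)) (Hk H₁k : ∀ i : KIdx 2 ℓ hd3 hL 1 1, B9.HKernel (geo9K i) (bgT3 i))
    (ev : ∀ i : KIdx 2 ℓ hd3 hL 1 1, (geo9K i).Loc → X i → ℝ) (evY : ∀ i : KIdx 2 ℓ hd3 hL 1 1, (geo9K i).Loc → Y i → ℝ)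
    (r Cev θ₁ θD θ₂ r₁ B₀ B₂ δ₀ δK σ ρ ρf a₁ M₁ B₃ δ₃ α : ℝ) (Bh Bi Bq θH θI : ℝ → ℝ) (Bi2 : ℝ → ℝ → ℝ)
    (hθ₁ : 0 ≤ θ₁) (hθD : 0 ≤ θD) (hθH : ∀ β, 0 ≤ β → β < 1 → 0 ≤ θH β) (hθI : ∀ ε, 0 < ε → 0 ≤ θI ε) (hθ₂ : 0 ≤ θ₂) (hr₁ : 0 ≤ r₁) (hB₀ : 0 ≤ B₀) (hB₂ : 0 ≤ B₂) (hB₃ : 0 ≤ B₃)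
    (hσ : 0 < σ) (hρ : 0 < ρ) (hρS : ρ ≤ δ₀) (hρδ : ρ + σ ≤ δK) (hρ₃ : ρ + σ ≤ δ₃) (ha₁ : 0 < a₁) (hM₁ : 0 < M₁)
    (hα : α ≤ 1 / 2) (hα0 : 0 < α) (hρf : 0 < ρf) (hρf1 : ρf + σ ≤ (1 - α) * ρ) (hρf2 : ρf + 2 * σ + α * ρ ≤ ρ)
    (hBh : ∀ β, 0 ≤ β → β < 1 → 0 ≤ Bh β) (hBi : ∀ ε, 0 < ε → ε ≤ 1 → 0 ≤ Bi ε)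
    (hBi2 : ∀ ε β, 0 < ε → ε ≤ 1 → 0 ≤ β → β < 1 → 0 ≤ Bi2 ε β) (hBq : ∀ β, 0 ≤ Bq β)
    (hCev : 0 ≤ Cev)
    (hcoR : ∀ (i : KIdx 2 ℓ hd3 hL 1 1) (U : (bgT3 i).Cfg),
      CoRealizesRel (GD i) 0 U (RelB i) (𝔬 i).blk (𝔬 i).blk (ev i) ((𝔬 i).G U) ∧
      CoRealizesRel (GD i) 2 U (RelB i) (𝔬 i).blk (𝔬 i).blkY (evY i) ((𝔬 i).G U ∘ₗ (𝔬 i).Dstar U) ∧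
      CoRealizesRel (G₁ i) 0 U (RelB i) (𝔬 i).blk (𝔬 i).blk (ev i) ((𝔬 i).G1 U) ∧
      CoRealizesRel (G₁ i) 2 U (RelB i) (𝔬 i).blk (𝔬 i).blkY (evY i) ((𝔬 i).G1 U ∘ₗ (𝔬 i).Dstar U))
    (hco1R : ∀ (i : KIdx 2 ℓ hd3 hL 1 1) (U : (bgT3 i).Cfg),
      CoRealizesRel (GD i) 1 U (RelB i) (𝔬 i).blkY (𝔬 i).blk (ev i) ((𝔬 i).D U ∘ₗ (𝔬 i).G U) ∧
      CoRealizesRel (G₁ i) 1 U (RelB i) (𝔬 i).blkY (𝔬 i).blk (ev i) ((𝔬 i).D U ∘ₗ (𝔬 i).G1 U))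
    (hcoHR : ∀ (i : KIdx 2 ℓ hd3 hL 1 1) (U : (bgT3 i).Cfg),
      CoRealizesHRel (Hk i) 0 U (2 + 1) (RelB i) (𝔬 i).blk (𝔬 i).blkZ ((𝔬 i).Hm U) ∧
      CoRealizesHRel (Hk i) 1 U (2 + 1) (RelB i) (𝔬 i).blkY (𝔬 i).blkZ ((𝔬 i).D U ∘ₗ (𝔬 i).Hm U) ∧
      CoRealizesHRel (H₁k i) 0 U (2 + 1) (RelB i) (𝔬 i).blk (𝔬 i).blkZ ((𝔬 i).H1m U) ∧
      CoRealizesHRel (H₁k i) 1 U (2 + 1) (RelB i) (𝔬 i).blkY (𝔬 i).blkZ ((𝔬 i).D U ∘ₗ (𝔬 i).H1m U))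
    (hcoG : ∀ (i : KIdx 2 ℓ hd3 hL 1 1) (U : (bgT3 i).Cfg),
      CoReadsGlob (GD i) 0 U (𝔬 i).blk (𝔬 i).blk (ev i) ((𝔬 i).G U) ∧
      CoReadsGlob (GD i) 1 U (𝔬 i).blkY (𝔬 i).blk (ev i) ((𝔬 i).D U ∘ₗ (𝔬 i).G U) ∧
      CoReadsGlob (GD i) 2 U (𝔬 i).blk (𝔬 i).blkY (evY i) ((𝔬 i).G U ∘ₗ (𝔬 i).Dstar U) ∧
      CoReadsGlob (G₁ i) 0 U (𝔬 i).blk (𝔬 i).blk (ev i) ((𝔬 i).G1 U) ∧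
      CoReadsGlob (G₁ i) 1 U (𝔬 i).blkY (𝔬 i).blk (ev i) ((𝔬 i).D U ∘ₗ (𝔬 i).G1 U) ∧
      CoReadsGlob (G₁ i) 2 U (𝔬 i).blk (𝔬 i).blkY (evY i) ((𝔬 i).G1 U ∘ₗ (𝔬 i).Dstar U))
    (hl2N : ∀ (i : KIdx 2 ℓ hd3 hL 1 1) (U : (bgT3 i).Cfg),
      (L2ReadsNbr (R := (1 : ℝ)) (H := H₀ i) (GD i) 0 U (RelB i) r Cev (𝔬 i).blk (𝔬 i).blk (ev i) ((𝔬 i).G U) ∧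
        L2ReadsNbr (R := (1 : ℝ)) (H := H₀ i) (GD i) 1 U (RelB i) r Cev (𝔬 i).blkY (𝔬 i).blk (ev i) ((𝔬 i).D U ∘ₗ (𝔬 i).G U) ∧
        L2ReadsNbr (R := (1 : ℝ)) (H := H₀ i) (GD i) 2 U (RelB i) r Cev (𝔬 i).blk (𝔬 i).blkY (evY i) ((𝔬 i).G U ∘ₗ (𝔬 i).Dstar U) ∧
        L2ReadsNbr (R := (1 : ℝ)) (H := H₀ i) (GD i) 3 U (RelB i) r Cev ((𝔬 i).blk ∘ Prod.fst) (𝔬 i).blk (ev i)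
          (familyOp (fun q : P × P => Dd i U q.1 ∘ₗ ((𝔬 i).G U ∘ₗ Dds i U q.2))) ∧
        L2ReadsNbr (R := (1 : ℝ)) (H := H₀ i) (GD i) 4 U (RelB i) r Cev ((𝔬 i).blk ∘ Prod.fst) (𝔬 i).blk (ev i)
          (familyOp (fun q : P × P => (Dd i U q.1 ∘ₗ Dd i U q.2) ∘ₗ (𝔬 i).G U)) ∧
        L2ReadsNbr (R := (1 : ℝ)) (H := H₀ i) (GD i) 5 U (RelB i) r Cev ((𝔬 i).blk ∘ Prod.fst) (𝔬 i).blk (ev i)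
          (familyOp (fun q : P × P => (𝔬 i).G U ∘ₗ (Dds i U q.1 ∘ₗ Dds i U q.2)))) ∧
      (L2ReadsNbr (R := (1 : ℝ)) (H := H₀ i) (G₁ i) 0 U (RelB i) r Cev (𝔬 i).blk (𝔬 i).blk (ev i) ((𝔬 i).G1 U) ∧
        L2ReadsNbr (R := (1 : ℝ)) (H := H₀ i) (G₁ i) 1 U (RelB i) r Cev (𝔬 i).blkY (𝔬 i).blk (ev i) ((𝔬 i).D U ∘ₗ (𝔬 i).G1 U) ∧
        L2ReadsNbr (R := (1 : ℝ)) (H := H₀ i) (G₁ i) 2 U (RelB i) r Cev (𝔬 i).blk (𝔬 i).blkY (evY i) ((𝔬 i).G1 U ∘ₗ (𝔬 i).Dstar U) ∧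
        L2ReadsNbr (R := (1 : ℝ)) (H := H₀ i) (G₁ i) 3 U (RelB i) r Cev ((𝔬 i).blk ∘ Prod.fst) (𝔬 i).blk (ev i)
          (familyOp (fun q : P × P => Dd i U q.1 ∘ₗ ((𝔬 i).G1 U ∘ₗ Dds i U q.2))) ∧
        L2ReadsNbr (R := (1 : ℝ)) (H := H₀ i) (G₁ i) 4 U (RelB i) r Cev ((𝔬 i).blk ∘ Prod.fst) (𝔬 i).blk (ev i)
          (familyOp (fun q : P × P => (Dd i U q.1 ∘ₗ Dd i U q.2) ∘ₗ (𝔬 i).G1 U)) ∧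
        L2ReadsNbr (R := (1 : ℝ)) (H := H₀ i) (G₁ i) 5 U (RelB i) r Cev ((𝔬 i).blk ∘ Prod.fst) (𝔬 i).blk (ev i)
          (familyOp (fun q : P × P => (𝔬 i).G1 U ∘ₗ (Dds i U q.1 ∘ₗ Dds i U q.2)))))
    (hH1N : ∀ (i : KIdx 2 ℓ hd3 hL 1 1) (U : (bgT3 i).Cfg),
      H1ReadsNbr (GD i) U (𝔭 i) (RelB i) r (𝔬 i).blk (𝔬 i).blkY (ev i) (evY i) ((𝔬 i).D U ∘ₗ (𝔬 i).G U)
        ((𝔬 i).G U ∘ₗ (𝔬 i).Dstar U) ∧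
      H1ReadsNbr (G₁ i) U (𝔭 i) (RelB i) r (𝔬 i).blk (𝔬 i).blkY (ev i) (evY i) ((𝔬 i).D U ∘ₗ (𝔬 i).G1 U)
        ((𝔬 i).G1 U ∘ₗ (𝔬 i).Dstar U))
    (hIF : ∀ (i : KIdx 2 ℓ hd3 hL 1 1) (U : (bgT3 i).Cfg),
      InputReadsFam (GD i) U (bHX i) r ((𝔬 i).blk ∘ Prod.fst) ((𝔭 i).blkPX ∘ Prod.fst) (fun β => sliceProbe ((𝔭 i).ΦX U β)) (ev i)
        (familyOp (fun q : P × P => Dd i U q.1 ∘ₗ ((𝔬 i).G U ∘ₗ Dds i U q.2))) ∧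
      InputReadsFam (G₁ i) U (bHX i) r ((𝔬 i).blk ∘ Prod.fst) ((𝔭 i).blkPX ∘ Prod.fst) (fun β => sliceProbe ((𝔭 i).ΦX U β)) (ev i)
        (familyOp (fun q : P × P => Dd i U q.1 ∘ₗ ((𝔬 i).G1 U ∘ₗ Dds i U q.2))))
    (hHCN : ∀ (i : KIdx 2 ℓ hd3 hL 1 1) (U : (bgT3 i).Cfg),
      CoReadsHHolderNbr (Hk i) U (2 + 1) (𝔭 i) r (𝔬 i).blkZ ((𝔬 i).D U ∘ₗ (𝔬 i).Hm U) ∧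
      CoReadsHHolderNbr (H₁k i) U (2 + 1) (𝔭 i) r (𝔬 i).blkZ ((𝔬 i).D U ∘ₗ (𝔬 i).H1m U))
    (hsym : ∀ i : KIdx 2 ℓ hd3 hL 1 1, M₁ ≤ (geo9K i).M → ∀ α₀ : ℝ, 0 < α₀ → (geo9K i).M * α₀ ≤ a₁ →
      ∀ U : (bgT3 i).Cfg, (bgT3 i).Reg335 c35 α₀ U → (bgT3 i).Reg336 c35 α₀ U →
        (IsTransposePair ((𝔬 i).G U) ((𝔬 i).G U) ∧ IsTransposePair ((𝔬 i).G1 U) ((𝔬 i).G1 U)) ∧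
        (IsTransposePair ((𝔬 i).D U ∘ₗ (𝔬 i).G U) ((𝔬 i).G U ∘ₗ (𝔬 i).Dstar U) ∧
          IsTransposePair ((𝔬 i).D U ∘ₗ (𝔬 i).G1 U) ((𝔬 i).G1 U ∘ₗ (𝔬 i).Dstar U)))
    (hmodel : ∀ i : KIdx 2 ℓ hd3 hL 1 1, M₁ ≤ (geo9K i).M → ∀ α₀ : ℝ, 0 < α₀ → (geo9K i).M * α₀ ≤ a₁ →
      ∀ U : (bgT3 i).Cfg, (bgT3 i).Reg335 c35 α₀ U → (bgT3 i).Reg336 c35 α₀ U →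
        Thm33G0 (𝔬 i) 1 (H₀ i) B₀ δ₀ U ∧
        Step (𝔬 i) 1 (H₀ i) (geoOK_geo9K i).lenle 1 (θ₁ * ((geo9K i).M * α₀)) δK U ∧
        Step (𝔬 i) 1 (H₀ i) (geoOK_geo9K i).lenle 2 (θ₁ * ((geo9K i).M * α₀)) δK U ∧
        FormSmall (𝔬 i) (r₁ * ((geo9K i).M * α₀)) U ∧ Identities (𝔬 i) U)
    (hleft : ∀ i : KIdx 2 ℓ hd3 hL 1 1, M₁ ≤ (geo9K i).M → ∀ α₀ : ℝ, 0 < α₀ → (geo9K i).M * α₀ ≤ a₁ →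
      ∀ U : (bgT3 i).Cfg, (bgT3 i).Reg335 c35 α₀ U → (bgT3 i).Reg336 c35 α₀ U →
        LeftStep (𝔬 i) 1 (H₀ i) (geoOK_geo9K i).lenle B₀ δ₀ (θD * ((geo9K i).M * α₀)) δK U)
    (bZ : ∀ i : KIdx 2 ℓ hd3 hL 1 1, BlockNorm (toB6 (geo9K i) 1 (H₀ i)) (Z i → ℝ)) (hκZ : ∀ i : KIdx 2 ℓ hd3 hL 1 1, (bZ i).κ = 1)
    (hlettersH : ∀ i : KIdx 2 ℓ hd3 hL 1 1, M₁ ≤ (geo9K i).M → ∀ α₀ : ℝ, 0 < α₀ → (geo9K i).M * α₀ ≤ a₁ →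
      ∀ U : (bgT3 i).Cfg, (bgT3 i).Reg335 c35 α₀ U → (bgT3 i).Reg336 c35 α₀ U →
        LettersHZ (𝔬 i) 1 (H₀ i) (geoOK_geo9K i) (bZ i) B₃ δ₃ U)
    (hG0C : ∀ i : KIdx 2 ℓ hd3 hL 1 1, M₁ ≤ (geo9K i).M → ∀ α₀ : ℝ, 0 < α₀ → (geo9K i).M * α₀ ≤ a₁ →
      ∀ U : (bgT3 i).Cfg, (bgT3 i).Reg335 c35 α₀ U → (bgT3 i).Reg336 c35 α₀ U →
        Thm33G0Dir (𝔬 i) (𝔭 i) (Dd i) (Dds i) 1 (H₀ i) (bHX i) B₀ Bh Bi Bi2 δ₀ U ∧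
          Thm33G0L2M (𝔬 i) (Dd i) (Dds i) 1 (H₀ i) B₂ δ₀ U)
    (hstepC : ∀ i : KIdx 2 ℓ hd3 hL 1 1, M₁ ≤ (geo9K i).M → ∀ α₀ : ℝ, 0 < α₀ → (geo9K i).M * α₀ ≤ a₁ →
      ∀ U : (bgT3 i).Cfg, (bgT3 i).Reg335 c35 α₀ U → (bgT3 i).Reg336 c35 α₀ U →
        StepDirB (𝔬 i) (𝔭 i) (Dd i) (Dds i) 1 (H₀ i) (bHX i) (geoOK_geo9K i).lenle (θD * ((geo9K i).M * α₀))
          (fun β => θH β * ((geo9K i).M * α₀)) (fun ε => θI ε * ((geo9K i).M * α₀)) δK U ∧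
        StepL2 (𝔬 i) 1 (H₀ i) (θ₂ * ((geo9K i).M * α₀)) δK U)
    (hLHH : ∀ i : KIdx 2 ℓ hd3 hL 1 1, M₁ ≤ (geo9K i).M → ∀ α₀ : ℝ, 0 < α₀ → (geo9K i).M * α₀ ≤ a₁ →
      ∀ U : (bgT3 i).Cfg, (bgT3 i).Reg335 c35 α₀ U → (bgT3 i).Reg336 c35 α₀ U →
        LettersHHZ (𝔬 i) (𝔭 i) 1 (H₀ i) (geoOK_geo9K i).lenle (bZ i) Bq δ₃ U)
    -- ======== the class-transfer row (BG-336) and the operator family read by `Hk`'s (3.133) entries through the (U)∕(Σ) pin ========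
    (hCT : ClassTransferT3 ℓ hL c35)
    {Xo Yo : ∀ i : KIdx 2 ℓ hd3 hL 1 1, (bgT3 i).Cfg → Type} [∀ i U, SeminormedAddCommGroup (Xo i U)] [∀ i U, SeminormedAddCommGroup (Yo i U)]
    (Hop : ∀ (i : KIdx 2 ℓ hd3 hL 1 1) (U : (bgT3 i).Cfg), Xo i U → Yo i U) (s : ℝ)
    (hls : ∀ (i : KIdx 2 ℓ hd3 hL 1 1) (y : (geo9K i).Site), (geo9K i).len y ^ s ≤ 1)
    (hpin : ∀ (i : KIdx 2 ℓ hd3 hL 1 1) (U : (bgT3 i).Cfg) (b : Xo i U) (c : ℝ), 0 ≤ c →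
      (∀ (n : Fin 2) (y : (geo9K i).Site),
          (geo9K i).len y ^ ((n : ℝ) + s) * (∑ y' : (geo9K i).Site, (Hk i).e n U y y' * (geo9K i).len y' ^ ((2 + 1 : ℕ) : ℝ)) * ‖b‖ ≤ c) →
        ‖Hop i U b‖ ≤ c) :
    ∃ M₄ a₀ B₀' : ℝ, 0 < M₄ ∧ 0 < a₀ ∧ 0 < B₀' ∧
      ∀ (hℓ : 4 ≤ ℓ) (m : ℕ) (hm : 1 ≤ m) (n K a' R : ℕ) (hk1 : 1 ≤ K - n) (hsize : a' + 3 ≤ m + n) (hM8 : 8 ≤ (ℓ + 1) ^ a') (hR2 : 2 * (ℓ + 1) ^ 2 ≤ R),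
        M₄ ≤ ((ℓ + 1 : ℕ) : ℝ) * (((ℓ + 1) ^ a' : ℕ) : ℝ) →
        ∀ (e : ℝ) (U₀ : GaugeField (PV 2 ℓ m K hd3 hL) 0 (Matrix.specialUnitaryGroup (Fin 2) ℂ)),
          RegPr (⟨ℓ + 1, hL, m, hm⟩ : T3Family) n K e U₀ → e ≤ a₀ / (((ℓ + 1 : ℕ) : ℝ) * (((ℓ + 1) ^ a' : ℕ) : ℝ)) →
            ∀ b : Xo (memberIdx ℓ hL hℓ m hm n K a' R hk1 hsize hM8 hR2) (cfgV1OfT3 U₀),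
              ‖Hop (memberIdx ℓ hL hℓ m hm n K a' R hk1 hsize hM8 hR2) (cfgV1OfT3 U₀) b‖ ≤ B₀' * ‖b‖ :=
  normH₁_row_of_recordObligations 𝔬 H₀ 𝔭 bHX Dd Dds GD G₁ Hk H₁k ev evY r Cev θ₁ θD θ₂ r₁ B₀ B₂ δ₀ δK σ ρ ρf a₁ M₁ B₃ δ₃ α Bh Bi Bq θH θI Bi2
    hθ₁ hθD hθH hθI hθ₂ hr₁ hB₀ hB₂ hB₃ hσ hρ hρS hρδ hρ₃ ha₁ hM₁ hα hα0 hρf hρf1 hρf2 hBh hBi hBi2 hBq hCev hcoR hco1R hcoHR hcoG hl2N hH1N hIF hHCN hsym hmodel hleft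
    bZ hκZ hlettersH hG0C hstepC hLHH hCT Hk (fun _ => Or.inl rfl) Hop s hls hpin

end Summit.QuantumFields.YangMills.Theorems.Prop7SectET3N06LeavesRecordNormH1

end
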